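import Literature.AlgebraicGeometry.Motives.MixedHodgeStructureKrullSchmidt
import Mathlib.LinearAlgebra.Projection
import HarnessLib

/-!
# The endomorphism algebra of a mixed Hodge structure; indecomposable ⇔ local endomorphism ring

For an object of an abelian category whose morphism spaces are finite-dimensional `ℚ`-vector spaces — here a mixed
Hodge structure on a finite-dimensional `ℚ`-space (Cattani–El Zein–Griffiths–Lê, *Hodge Theory*, Thm. 3.2.18) — the
endomorphism ring `E = End(H)` is a finite-dimensional `ℚ`-algebra, and Lam's (19.17) holds: **`H` is indecomposable
iff `E` is a local ring, and then every non-unit of `E` is nilpotent** ("`m = rad E` is nil"); by (19.2)(c) a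
local ring has no nontrivial idempotents, and conversely an object all of whose idempotent endomorphisms are trivial
is indecomposable because idempotents split (kernel and image are complementary sub-MHS). Namespace
`MixedHodgeStructure`; everything proved, no named facts:

* §1 **`endAlg H`**, the `ℚ`-subalgebra of `Module.End ℚ V` of underlying maps of endomorphisms of `H`
  (`mem_endAlg_iff`, `endAlg.toHom`, `Hom.toEndAlg`, finite-dimensionality, units = bijective endomorphisms);
* §2 idempotents split: **`isIndecomposable_iff_forall_isIdempotentElem`** (`H ≠ 0` is indecomposable iff `0` and
  `1` are the only idempotents of `End(H)`);
* §3 **`isIndecomposable_iff_isLocalRing`** (Lam (19.17) with (19.12): indecomposable ⇔ strongly indecomposable),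
  **`IsIndecomposable.isNilpotent_of_not_isUnit`** (the maximal ideal is nil);
* §4 Schur: for simple `H` every non-zero endomorphism is a unit (`IsSimple.isUnit_of_ne_zero`), so `End(H)` is a
  division ring and in particular local.

## References

* [Lam2001FirstCourse] T. Y. Lam, A First Course in Noncommutative Rings, 2nd ed. (2001), (19.2)(c), (19.12), Thm.
  (19.17) (pp. 281–287); Schur's Lemma (3.6).
* [CattaniElZeinGriffithsLe2014] E. Cattani et al. (eds.), Hodge Theory (2014), Thm. 3.2.18, Lemma 3.2.20, p. 270.
-/

noncomputable section

namespace Literature.AlgebraicGeometry.Motives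

namespace MixedHodgeStructure

universe u

variable {V : Type u} [AddCommGroup V] [Module ℚ V]

open Module SubMixedHodgeStructure

/-! ### §1 The endomorphism algebra -/

/-- **The endomorphism algebra `End(H)` of a mixed Hodge structure**, as the `ℚ`-subalgebra of `Module.End ℚ V` of
the `ℚ`-linear maps preserving `W_•` whose complexification preserves `F^•` — exactly the underlying maps of the
tree's `Hom H H` (the `Hom`-sets of the abelian category of MHS are `ℚ`-vector spaces, composition is bilinear).
[cite: CattaniElZeinGriffithsLe2014, Thm. 3.2.18] -/
def endAlg (H : MixedHodgeStructure V) : Subalgebra ℚ (Module.End ℚ V) where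
  carrier := {a | (∀ k, (H.W k).map a ≤ H.W k) ∧ ∀ p, (H.F p).map (a.baseChange ℂ) ≤ H.F p}
  mul_mem' {a b} ha hb :=
    ⟨fun k => by
      rw [Module.End.mul_eq_comp, Submodule.map_comp]
      exact (Submodule.map_mono (hb.1 k)).trans (ha.1 k),
    fun p => by
      rw [Module.End.mul_eq_comp, LinearMap.baseChange_comp, Submodule.map_comp]
      exact (Submodule.map_mono (hb.2 p)).trans (ha.2 p)⟩
  one_mem' :=
    ⟨fun k => by rw [Module.End.one_eq_id, Submodule.map_id],
    fun p => by rw [Module.End.one_eq_id, LinearMap.baseChange_id, Submodule.map_id]⟩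
  add_mem' {a b} ha hb :=
    ⟨fun k => by
      rintro x ⟨y, hy, rfl⟩
      exact add_mem (ha.1 k ⟨y, hy, rfl⟩) (hb.1 k ⟨y, hy, rfl⟩),
    fun p => by
      rintro x ⟨y, hy, rfl⟩
      rw [LinearMap.baseChange_add, LinearMap.add_apply]
      exact add_mem (ha.2 p ⟨y, hy, rfl⟩) (hb.2 p ⟨y, hy, rfl⟩)⟩
  zero_mem' :=
    ⟨fun k => by rw [Submodule.map_zero]; exact bot_le,
    fun p => by rw [LinearMap.baseChange_zero, Submodule.map_zero]; exact bot_le⟩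
  algebraMap_mem' c :=
    ⟨fun k => by
      rintro x ⟨y, hy, rfl⟩
      rw [Algebra.algebraMap_eq_smul_one, LinearMap.smul_apply, Module.End.one_apply]
      exact Submodule.smul_mem _ c hy,
    fun p => by
      rintro x ⟨y, hy, rfl⟩
      rw [Algebra.algebraMap_eq_smul_one, LinearMap.baseChange_smul, LinearMap.smul_apply,
        Module.End.one_eq_id, LinearMap.baseChange_id, LinearMap.id_apply]
      exact Submodule.smul_of_tower_mem _ c hy⟩

variable {H : MixedHodgeStructure V}

variable (H) in
/-- Membership in `End(H)`. [cite: CattaniElZeinGriffithsLe2014, Thm. 3.2.18] -/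
theorem mem_endAlg_iff (a : Module.End ℚ V) :
    a ∈ H.endAlg ↔ (∀ k, (H.W k).map a ≤ H.W k) ∧ ∀ p, (H.F p).map (a.baseChange ℂ) ≤ H.F p :=
  Iff.rfl

/-- The underlying map of an endomorphism of MHS lies in `End(H)`. [cite: CattaniElZeinGriffithsLe2014, Thm. 3.2.18] -/
theorem Hom.toLinearMap_mem_endAlg (f : Hom H H) : f.toLinearMap ∈ H.endAlg :=
  ⟨f.map_W_le, f.map_F_le⟩

/-- An endomorphism of MHS as an element of `End(H)`. [cite: CattaniElZeinGriffithsLe2014, Thm. 3.2.18] -/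
def Hom.toEndAlg (f : Hom H H) : H.endAlg :=
  ⟨f.toLinearMap, f.toLinearMap_mem_endAlg⟩

/-- Underlying map of `f.toEndAlg` (by `rfl`). [cite: CattaniElZeinGriffithsLe2014, Thm. 3.2.18] -/
@[simp]
theorem Hom.coe_toEndAlg (f : Hom H H) : (f.toEndAlg : Module.End ℚ V) = f.toLinearMap := rfl

/-- An element of `End(H)` as an endomorphism of MHS. [cite: CattaniElZeinGriffithsLe2014, Thm. 3.2.18] -/
def endAlg.toHom (a : H.endAlg) : Hom H H where
  toLinearMap := a
  map_W_le := a.2.1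
  map_F_le := a.2.2

/-- Underlying map of `endAlg.toHom a` (by `rfl`). [cite: CattaniElZeinGriffithsLe2014, Thm. 3.2.18] -/
@[simp]
theorem endAlg.toHom_toLinearMap (a : H.endAlg) : (endAlg.toHom a).toLinearMap = a := rfl

/-- `toHom` and `toEndAlg` are inverse to each other. [cite: CattaniElZeinGriffithsLe2014, Thm. 3.2.18] -/
@[simp]
theorem endAlg.toEndAlg_toHom (a : H.endAlg) : (endAlg.toHom a).toEndAlg = a := rfl

/-- `toEndAlg` and `toHom` are inverse to each other. [cite: CattaniElZeinGriffithsLe2014, Thm. 3.2.18] -/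
@[simp]
theorem Hom.toHom_toEndAlg (f : Hom H H) : endAlg.toHom f.toEndAlg = f := rfl

/-- `toEndAlg` is multiplicative: composition goes to the product. [cite: CattaniElZeinGriffithsLe2014, Thm. 3.2.18] -/
theorem Hom.toEndAlg_comp (f g : Hom H H) : (f.comp g).toEndAlg = f.toEndAlg * g.toEndAlg := rfl

/-- `toEndAlg` is additive. [cite: CattaniElZeinGriffithsLe2014, Thm. 3.2.18] -/
theorem Hom.toEndAlg_add (f g : Hom H H) : (f.add g).toEndAlg = f.toEndAlg + g.toEndAlg := rfl

variable (H) in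
/-- `toEndAlg (id) = 1`. [cite: CattaniElZeinGriffithsLe2014, Thm. 3.2.18] -/
theorem Hom.toEndAlg_id : (Hom.id H).toEndAlg = 1 := rfl

variable (H) in
/-- **`End(H)` is a finite-dimensional `ℚ`-algebra** (a subalgebra of `End_ℚ(V)`). [cite: CattaniElZeinGriffithsLe2014, Thm. 3.2.18] -/
theorem finiteDimensional_endAlg [FiniteDimensional ℚ V] : FiniteDimensional ℚ H.endAlg :=
  Module.Finite.of_injective (Subalgebra.val H.endAlg).toLinearMap Subtype.val_injective

variable (H) in
/-- Hence `End(H)` is a (left) Artinian ring. [cite: Lam2001FirstCourse, Thm. (19.17), p. 285] -/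
theorem isArtinianRing_endAlg [FiniteDimensional ℚ V] : IsArtinianRing H.endAlg := by
  haveI := finiteDimensional_endAlg H
  exact isArtinian_of_tower ℚ (inferInstance : IsArtinian ℚ H.endAlg)

/-- **The units of `End(H)` are the bijective endomorphisms** ("a morphism of MHS bijective on the lattices is an
isomorphism of MHS": the inverse is again a morphism). [cite: CattaniElZeinGriffithsLe2014, Thm. 3.2.18] -/
theorem endAlg.isUnit_iff_bijective (a : H.endAlg) : IsUnit a ↔ Function.Bijective (a : Module.End ℚ V) := by
  constructor
  · intro h
    exact (Module.End.isUnit_iff _).1 (h.map H.endAlg.val)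
  · intro h
    let b : H.endAlg := ((endAlg.toHom a).inverse h).toEndAlg
    have hba : b * a = 1 := Subtype.ext (congrArg Hom.toLinearMap (Hom.inverse_comp (endAlg.toHom a) h))
    have hab : a * b = 1 := Subtype.ext (congrArg Hom.toLinearMap (Hom.comp_inverse (endAlg.toHom a) h))
    exact ⟨⟨a, b, hab, hba⟩, rfl⟩

/-- `End(H)` is the zero ring iff `H = 0`; it is non-trivial iff `V` is. [cite: CattaniElZeinGriffithsLe2014, Thm. 3.2.18] -/
theorem nontrivial_endAlg_iff : Nontrivial H.endAlg ↔ Nontrivial V := by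
  constructor
  · intro h
    by_contra hV
    haveI := not_nontrivial_iff_subsingleton.1 hV
    obtain ⟨a, b, hab⟩ := h
    exact hab (Subtype.ext (LinearMap.ext fun x => Subsingleton.elim _ _))
  · intro hV
    refine ⟨⟨0, 1, fun h => ?_⟩⟩
    obtain ⟨x, hx⟩ := exists_ne (0 : V)
    have h' := congrArg (fun c : H.endAlg => (c : Module.End ℚ V) x) h
    simp only [ZeroMemClass.coe_zero, LinearMap.zero_apply, OneMemClass.coe_one, Module.End.one_apply] at h'
    exact hx h'.symm

/-! ### §2 Idempotents split: indecomposable ⇔ only trivial idempotents -/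

/-- **Idempotent endomorphisms split**: for `e ∈ End(H)` with `e² = e`, `Ker e ⊕ Im e = H` with both summands
sub-MHS. [cite: CattaniElZeinGriffithsLe2014, Lemma 3.2.20] [cite: Lam2001FirstCourse, (19.2), p. 281] -/
theorem Hom.isCompl_ker_range_of_isIdempotentElem (e : Hom H H) (he : IsIdempotentElem e.toLinearMap) :
    IsCompl e.ker.toSubmodule e.range.toSubmodule := by
  rw [Hom.ker_toSubmodule, Hom.range_toSubmodule]
  exact (LinearMap.IsIdempotentElem.isCompl he).symm

/-- **`H ≠ 0` is indecomposable iff `0` and `1` are the only idempotents of `End(H)`** (idempotents split into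
complementary sub-MHS; conversely the projections of a decomposition are idempotent endomorphisms).
[cite: Lam2001FirstCourse, (19.2)(c) and Thm. (19.17), pp. 281–285] [cite: CattaniElZeinGriffithsLe2014, Thm. 3.2.18 and p. 270] -/
theorem isIndecomposable_iff_forall_isIdempotentElem [FiniteDimensional ℚ V] :
    H.IsIndecomposable ↔ Nontrivial V ∧ ∀ a : H.endAlg, IsIdempotentElem a → a = 0 ∨ a = 1 := by
  constructor
  · intro h
    refine ⟨h.nontrivial, fun a ha => ?_⟩
    have ha' : IsIdempotentElem (a : Module.End ℚ V) := congrArg Subtype.val ha.eq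
    rcases h.eq_bot_or_eq_bot _ _ ((endAlg.toHom a).isCompl_ker_range_of_isIdempotentElem ha') with hk | hr
    · -- `Ker a = 0`: `a` is injective, hence bijective, and a bijective idempotent is `1`
      right
      rw [Hom.ker_toSubmodule, endAlg.toHom_toLinearMap, LinearMap.ker_eq_bot] at hk
      have hb : Function.Bijective (a : Module.End ℚ V) := ⟨hk, LinearMap.injective_iff_surjective.1 hk⟩
      exact (IsIdempotentElem.iff_eq_one_of_isUnit ((endAlg.isUnit_iff_bijective a).2 hb)).1 ha
    · -- `Im a = 0`: `a = 0`
      left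
      rw [Hom.range_toSubmodule, endAlg.toHom_toLinearMap, LinearMap.range_eq_bot] at hr
      exact Subtype.ext hr
  · rintro ⟨hV, h⟩
    refine ⟨hV, fun S T hST => ?_⟩
    -- the projection `e_T = ι_T ∘ π_T` onto `T` along `S` is an idempotent endomorphism
    let e : Hom H H := T.subtype.comp (projOfIsCompl S T hST)
    have he_apply_T : ∀ t : ↥T.toSubmodule, e.toLinearMap t = t := fun t => by
      change (T.toSubmodule.subtype ((projOfIsCompl S T hST).toLinearMap t)) = t
      rw [projOfIsCompl_apply_of_mem_right]; rfl
    have he : IsIdempotentElem e.toEndAlg := by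
      refine Subtype.ext (LinearMap.ext fun x => ?_)
      change e.toLinearMap (e.toLinearMap x) = e.toLinearMap x
      exact he_apply_T _
    rcases h _ he with h0 | h1
    · -- `e = 0`: `T = 0`
      right
      rw [eq_bot_iff]
      intro t ht
      have h' := congrArg (fun c : H.endAlg => (c : Module.End ℚ V) t) h0
      simp only [Hom.coe_toEndAlg, ZeroMemClass.coe_zero, LinearMap.zero_apply] at h'
      rw [Submodule.mem_bot, ← h', he_apply_T ⟨t, ht⟩]
    · -- `e = 1`: `S ⊆ Ker e = 0`
      left
      rw [eq_bot_iff]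
      intro s hs
      have h' := congrArg (fun c : H.endAlg => (c : Module.End ℚ V) s) h1
      simp only [Hom.coe_toEndAlg, OneMemClass.coe_one, Module.End.one_apply] at h'
      rw [Submodule.mem_bot, ← h']
      change (T.toSubmodule.subtype ((projOfIsCompl S T hST).toLinearMap s)) = 0
      rw [projOfIsCompl_apply_of_mem_left S T hST hs]; rfl

/-! ### §3 Indecomposable ⇔ the endomorphism ring is local; the maximal ideal is nil -/

section Local

variable [FiniteDimensional ℚ V]

/-- **Lam (19.17): an indecomposable MHS has a local endomorphism ring** (Fitting: every endomorphism is bijective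
or nilpotent, so of `a`, `b` with `a + b = 1` one is a unit — the tree's `bijective_or_bijective_of_bijective_add`).
[cite: Lam2001FirstCourse, Thm. (19.17), p. 285] [cite: CattaniElZeinGriffithsLe2014, Thm. 3.2.18 and p. 270] -/
theorem IsIndecomposable.isLocalRing (h : H.IsIndecomposable) : IsLocalRing H.endAlg := by
  haveI : Nontrivial H.endAlg := nontrivial_endAlg_iff.2 h.nontrivial
  refine IsLocalRing.of_is_unit_or_is_unit_of_add_one fun {a b} hab => ?_
  have hsum : Function.Bijective ((endAlg.toHom a).add (endAlg.toHom b)).toLinearMap := by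
    have h1 : ((endAlg.toHom a).add (endAlg.toHom b)).toLinearMap = ((a + b : H.endAlg) : Module.End ℚ V) := rfl
    rw [h1, hab, OneMemClass.coe_one, Module.End.one_eq_id]
    exact Function.bijective_id
  rcases h.bijective_or_bijective_of_bijective_add _ _ hsum with ha | hb
  · exact Or.inl ((endAlg.isUnit_iff_bijective a).2 ha)
  · exact Or.inr ((endAlg.isUnit_iff_bijective b).2 hb)

/-- **Conversely (Lam (19.12) with (19.2)(c)): if `End(H)` is local then `H` is indecomposable** — a local ring has
no nontrivial idempotents. [cite: Lam2001FirstCourse, (19.2)(c) and (19.12), pp. 281–284] -/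
theorem isIndecomposable_of_isLocalRing (h : IsLocalRing H.endAlg) : H.IsIndecomposable := by
  refine isIndecomposable_iff_forall_isIdempotentElem.2 ⟨nontrivial_endAlg_iff.1 h.toNontrivial, fun a ha => ?_⟩
  rcases IsLocalRing.isUnit_or_isUnit_of_add_one (add_sub_cancel a 1) with hu | hu
  · exact Or.inr ((IsIdempotentElem.iff_eq_one_of_isUnit hu).1 ha)
  · -- `1 - a` is a unit and idempotent, hence `1`, so `a = 0`
    left
    have h1 : (1 - a) = 1 := (IsIdempotentElem.iff_eq_one_of_isUnit hu).1 ha.one_sub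
    have h2 : a = 1 - (1 - a) := (sub_sub_cancel 1 a).symm
    rw [h2, h1, sub_self]

/-- **Indecomposable ⇔ strongly indecomposable** for mixed Hodge structures: `H` is indecomposable iff `End(H)` is a
local ring. [cite: Lam2001FirstCourse, (19.12) and Thm. (19.17), pp. 284–285] [cite: CattaniElZeinGriffithsLe2014, p. 270] -/
theorem isIndecomposable_iff_isLocalRing : H.IsIndecomposable ↔ IsLocalRing H.endAlg :=
  ⟨IsIndecomposable.isLocalRing, isIndecomposable_of_isLocalRing⟩

/-- **The maximal ideal of `End(H)` is nil** for indecomposable `H`: every non-unit endomorphism is nilpotent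
(Fitting). [cite: Lam2001FirstCourse, Thm. (19.17), p. 285] -/
theorem IsIndecomposable.isNilpotent_of_not_isUnit (h : H.IsIndecomposable) (a : H.endAlg) (ha : ¬IsUnit a) :
    IsNilpotent a := by
  have hn : IsNilpotent (a : Module.End ℚ V) :=
    h.isNilpotent_of_not_bijective (endAlg.toHom a) fun hb => ha ((endAlg.isUnit_iff_bijective a).2 hb)
  obtain ⟨n, hn⟩ := hn
  exact ⟨n, Subtype.ext (by rw [Subalgebra.coe_pow, hn]; rfl)⟩

/-- For indecomposable `H`: an endomorphism is a unit or nilpotent. [cite: Lam2001FirstCourse, Thm. (19.17), p. 285] -/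
theorem IsIndecomposable.isUnit_or_isNilpotent (h : H.IsIndecomposable) (a : H.endAlg) : IsUnit a ∨ IsNilpotent a :=
  (em (IsUnit a)).imp_right (h.isNilpotent_of_not_isUnit a)

/-- For indecomposable `H` the non-units of `End(H)` are closed under addition (they form the maximal ideal).
[cite: Lam2001FirstCourse, (19.1) and Thm. (19.17), pp. 280–285] -/
theorem IsIndecomposable.not_isUnit_add (h : H.IsIndecomposable) {a b : H.endAlg} (ha : ¬IsUnit a) (hb : ¬IsUnit b) :
    ¬IsUnit (a + b) := fun hab => by
  rw [endAlg.isUnit_iff_bijective] at ha hb hab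
  exact h.not_bijective_add (endAlg.toHom a) (endAlg.toHom b) ha hb hab

/-- … and under left and right multiplication. [cite: Lam2001FirstCourse, (19.1) and Thm. (19.17), pp. 280–285] -/
theorem not_isUnit_mul_of_right {a : H.endAlg} (b : H.endAlg) (ha : ¬IsUnit a) : ¬IsUnit (b * a) := fun h => by
  rw [endAlg.isUnit_iff_bijective] at ha h
  exact Hom.not_bijective_comp_of_right (endAlg.toHom b) (endAlg.toHom a) ha h

/-- … and under left and right multiplication. [cite: Lam2001FirstCourse, (19.1) and Thm. (19.17), pp. 280–285] -/
theorem not_isUnit_mul_of_left {a : H.endAlg} (b : H.endAlg) (ha : ¬IsUnit a) : ¬IsUnit (a * b) := fun h => by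
  rw [endAlg.isUnit_iff_bijective] at ha h
  exact Hom.not_bijective_comp_of_left (endAlg.toHom a) (endAlg.toHom b) ha h

end Local

/-! ### §4 Schur's lemma: the endomorphism ring of a simple MHS is a division ring -/

/-- **Schur's lemma in `End(H)`**: every non-zero element of `End(H)` is a unit for simple `H` — `End(H)` is a
division ring (the tree's `IsSimple.bijective_of_ne_zero`). [cite: Lam2001FirstCourse, (3.6) Schur's Lemma, p. 33]
[cite: CattaniElZeinGriffithsLe2014, Thm. 3.2.18 and p. 270] -/
theorem IsSimple.isUnit_of_ne_zero [FiniteDimensional ℚ V] (h : H.IsSimple) (a : H.endAlg) (ha : a ≠ 0) : IsUnit a :=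
  (endAlg.isUnit_iff_bijective a).2 (h.bijective_of_ne_zero h (f := endAlg.toHom a) fun h0 =>
    ha (Subtype.ext (congrArg Hom.toLinearMap h0)))

/-- For simple `H`: `a ∈ End(H)` is a unit iff `a ≠ 0`. [cite: Lam2001FirstCourse, (3.6) Schur's Lemma, p. 33] -/
theorem IsSimple.isUnit_iff_ne_zero [FiniteDimensional ℚ V] (h : H.IsSimple) (a : H.endAlg) : IsUnit a ↔ a ≠ 0 := by
  haveI : Nontrivial H.endAlg := nontrivial_endAlg_iff.2 h.nontrivial
  exact ⟨fun hu h0 => not_isUnit_zero (h0 ▸ hu), h.isUnit_of_ne_zero a⟩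

/-- In particular `End(H)` is local for simple `H` (Lam (19.13)). [cite: Lam2001FirstCourse, (19.13), p. 284] -/
theorem IsSimple.isLocalRing [FiniteDimensional ℚ V] (h : H.IsSimple) : IsLocalRing H.endAlg :=
  h.isIndecomposable.isLocalRing

end MixedHodgeStructure

end Literature.AlgebraicGeometry.Motives
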